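import Mathlib.LinearAlgebra.SesquilinearForm.Basic
import Mathlib.Tactic.LinearCombination
import Literature.LinearAlgebra.Semilinear.RankOneHermitianRigidity
import HarnessLib

/-!
# Rank-one hermitian rigidity, quadratic form: the values `h(x, a x)`, `a` self-adjoint, determine `x` up to `U(1)`

Topic `LinearAlgebra/Semilinear`; namespace `Literature.LinearAlgebra.Semilinear`.  KERNEL ONLY (theorems; Mathlib and
`Semilinear/RankOneHermitianRigidity` only; no named fact, no definition).

Setting, as in `Semilinear/RankOneHermitianRigidity` ([Lang2002, Ch. XV §5]): `K` a field, `σ : K →+* K`, `V` a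
`K`-module and `B : V →ₛₗ[σ] V →ₗ[K] K` (`B x v` is the classical `h(v, x)`: linear in `v`, `σ`-semilinear in `x`).
Write `P_x(v, w) := h(v, x) σ(h(w, x)) = B x v * σ (B x w)` for the matrix coefficients of the rank-one hermitian
operator `h(·, x) x` attached to `x`, and `N_x(v) := P_x(v, v)` for its diagonal coefficients.

* **Polarisation** — NO hypothesis on `K`, `σ` or `B`: `forall_mul_apply_eq_of_forall_mul_apply_self_eq`: if
  `N_x = N_{x'}` then `P_x = P_{x'}`.  Proof: `N(v + w) - N(v) - N(w) = P(v, w) + P(w, v)`, and replacing `v` by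
  `c • v` the sums `c P(v, w) + σ(c) P(w, v)` agree for every scalar `c`
  (`mul_mul_apply_add_of_forall_add_mul_apply_eq`); if `σ a ≠ a` for some `a`, the identities at `c = 1` and `c = a`
  give `(a - σ a) P_x(w, v) = (a - σ a) P_{x'}(w, v)` (`forall_mul_apply_eq_of_forall_add_mul_apply_eq_of_ne`, any
  characteristic); if `σ = id` the coefficients are symmetric and `2 P_x = 2 P_{x'}`
  (`forall_mul_apply_eq_of_forall_add_mul_apply_eq_of_two_ne_zero`), and in the remaining case `σ = id`, `2 = 0` the
  hypothesis itself reads `(h(v, x) - h(v, x'))² = 0`.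
* **Rigidity from the diagonal** (`σ` an involution, `B` separating on the left, via
  `exists_smul_eq_of_forall_mul_apply_eq` of `Semilinear/RankOneHermitianRigidity`):
  `exists_smul_eq_of_forall_mul_apply_self_eq` — `N_x = N_{x'}` ⇒ `x' = λ • x` with `λ σ(λ) = 1`; `iff` form
  `forall_mul_apply_self_eq_iff`.
* **Operator forms** (`B` moreover hermitian, `LinearMap.IsSymm B`, i.e. `σ (B x y) = B y x`): the rank-one operator
  `a_v := (B v).smulRight v : y ↦ h(y, v) v` is `B`-self-adjoint (`smulRight_selfAdjoint`) with
  `B (a_v x) x = h(x, a_v x) = N_x(v)` (`apply_smulRight_apply_self`); the rank-two one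
  `a_{v,w} := (B v).smulRight w + (B w).smulRight v` has `B (a_{v,w} x) x = P_x(v, w) + P_x(w, v)`
  (`apply_smulRight_add_smulRight_apply_self`).  Hence `exists_smul_eq_of_forall_smulRight_apply_self_eq` (hypothesis
  on the `a_v` only) and the headline `exists_smul_eq_of_forall_selfAdjoint_apply_self_eq`: if
  `B (a x) x = B (a x') x'` for every `B`-self-adjoint `a : V →ₗ[K] V` (`∀ u w, B (a u) w = B u (a w)`, the spelling
  of `Semilinear/DoubledCayleySiegel`), then `x' = λ • x` with `λ σ(λ) = 1`.  Converse `apply_self_eq_of_smul_eq`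
  (for every linear `a`) and the `iff` form `forall_selfAdjoint_apply_self_eq_iff`.  Neither finite dimension, nor
  `2 ≠ 0`, nor an element `δ` with `σ δ = -δ` is needed.

This is injectivity modulo `U(1) = {λ : λ σ(λ) = 1}` of the quadratic moment map `x ↦ (a ↦ h(x, a x))` of the unitary
dual pair `(U(1), U(V))`: a vector of a non-degenerate hermitian space is determined up to a norm-one scalar by the values
at it of the quadratic forms of the self-adjoint operators ([Howe1979] §11, [MoeglinVignerasWaldspurger1987] Ch. 3; the
linear algebra is that of [Lang2002, Ch. XV §5]).  Not here: anything topological or representation-theoretic.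

## References
* S. Lang, *Algebra*, rev. 3rd ed., GTM 211 (2002), Ch. XV §5 [Lang2002].
* R. Howe, *θ-series and invariant theory*, Proc. Sympos. Pure Math. 33.1 (1979), §11 [Howe1979].
* C. Mœglin, M.-F. Vignéras, J.-L. Waldspurger, *Correspondances de Howe sur un corps p-adique*, LNM 1291 (1987), Ch. 3
  [MoeglinVignerasWaldspurger1987].
-/

set_option autoImplicit false

namespace Literature.LinearAlgebra.Semilinear

variable {K : Type*} [Field K] {V : Type*} [AddCommGroup V] [Module K V] {σ : K →+* K}

/-! ## Polarisation of the coefficient identities -/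

/-- Scaling the symmetrised coefficient identity: if `P_x(v, w) + P_x(w, v) = P_{x'}(v, w) + P_{x'}(w, v)` for all
`v, w` (where `P_x(v, w) = B x v * σ (B x w) = h(v, x) σ(h(w, x))`), then, replacing `v` by `c • v`,
`c P_x(v, w) + σ(c) P_x(w, v) = c P_{x'}(v, w) + σ(c) P_{x'}(w, v)` for every scalar `c`.
[cite: Lang2002, Ch. XV §5] -/
theorem mul_mul_apply_add_of_forall_add_mul_apply_eq (B : V →ₛₗ[σ] V →ₗ[K] K) {x x' : V}
    (h : ∀ v w : V,
      B x v * σ (B x w) + B x w * σ (B x v) = B x' v * σ (B x' w) + B x' w * σ (B x' v))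
    (c : K) (v w : V) :
    c * (B x v * σ (B x w)) + σ c * (B x w * σ (B x v)) =
      c * (B x' v * σ (B x' w)) + σ c * (B x' w * σ (B x' v)) := by
  have e := h (c • v) w
  simp only [map_smul, smul_eq_mul, map_mul] at e
  linear_combination e

/-- **Polarisation, case `σ ≠ id`.**  If `σ a ≠ a` for some `a : K` and the symmetrised coefficients of `x, x'`
agree, `P_x(v, w) + P_x(w, v) = P_{x'}(v, w) + P_{x'}(w, v)` for all `v, w`, then all coefficients agree,
`P_x(v, w) = P_{x'}(v, w)`: the identities of `mul_mul_apply_add_of_forall_add_mul_apply_eq` at `c = 1` and `c = a`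
give `(a - σ a) P_x(v, w) = (a - σ a) P_{x'}(v, w)`.  No assumption on the characteristic.
[cite: Lang2002, Ch. XV §5] -/
theorem forall_mul_apply_eq_of_forall_add_mul_apply_eq_of_ne (B : V →ₛₗ[σ] V →ₗ[K] K) {a : K} (ha : σ a ≠ a)
    {x x' : V}
    (h : ∀ v w : V,
      B x v * σ (B x w) + B x w * σ (B x v) = B x' v * σ (B x' w) + B x' w * σ (B x' v))
    (v w : V) : B x v * σ (B x w) = B x' v * σ (B x' w) := by
  have h1 := h w v
  have h2 := mul_mul_apply_add_of_forall_add_mul_apply_eq B h a w v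
  refine mul_left_cancel₀ (sub_ne_zero.mpr (Ne.symm ha)) ?_
  linear_combination a * h1 - h2

/-- **Polarisation, case `2 ≠ 0`.**  If `2 ≠ 0` in `K` and the symmetrised coefficients of `x, x'` agree,
`P_x(v, w) + P_x(w, v) = P_{x'}(v, w) + P_{x'}(w, v)` for all `v, w`, then all coefficients agree (if `σ ≠ id`
this is `forall_mul_apply_eq_of_forall_add_mul_apply_eq_of_ne`; if `σ = id` the coefficients are symmetric in
`v, w` and the hypothesis reads `2 P_x = 2 P_{x'}`). [cite: Lang2002, Ch. XV §5] -/
theorem forall_mul_apply_eq_of_forall_add_mul_apply_eq_of_two_ne_zero (B : V →ₛₗ[σ] V →ₗ[K] K)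
    (h2 : (2 : K) ≠ 0) {x x' : V}
    (h : ∀ v w : V,
      B x v * σ (B x w) + B x w * σ (B x v) = B x' v * σ (B x' w) + B x' w * σ (B x' v))
    (v w : V) : B x v * σ (B x w) = B x' v * σ (B x' w) := by
  by_cases hid : ∀ a : K, σ a = a
  · have h1 := h v w
    simp only [hid] at h1 ⊢
    refine mul_left_cancel₀ h2 ?_
    linear_combination h1
  · push Not at hid
    obtain ⟨a, ha⟩ := hid
    exact forall_mul_apply_eq_of_forall_add_mul_apply_eq_of_ne B ha h v w

/-- **Polarisation of the rank-one coefficients (no hypotheses).**  For any field `K`, ring endomorphism `σ` of `K`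
and form `B : V →ₛₗ[σ] V →ₗ[K] K`: if the diagonal coefficients of `x, x'` agree,
`h(v, x) σ(h(v, x)) = h(v, x') σ(h(v, x'))` for all `v`, then all coefficients agree,
`h(v, x) σ(h(w, x)) = h(v, x') σ(h(w, x'))` for all `v, w`.  (Polarise: `N(v + w) - N(v) - N(w) = P(v, w) + P(w, v)`;
then `…_of_ne` if `σ ≠ id`, `…_of_two_ne_zero` if `2 ≠ 0`, and if `σ = id` and `2 = 0` the hypothesis is
`(h(v, x) - h(v, x'))² = 0`, i.e. `h(·, x) = h(·, x')`.) [cite: Lang2002, Ch. XV §5] -/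
theorem forall_mul_apply_eq_of_forall_mul_apply_self_eq (B : V →ₛₗ[σ] V →ₗ[K] K) {x x' : V}
    (h : ∀ v : V, B x v * σ (B x v) = B x' v * σ (B x' v)) (v w : V) :
    B x v * σ (B x w) = B x' v * σ (B x' w) := by
  have hT : ∀ v w : V,
      B x v * σ (B x w) + B x w * σ (B x v) = B x' v * σ (B x' w) + B x' w * σ (B x' v) := fun v w => by
    have e := h (v + w)
    simp only [map_add] at e
    linear_combination e - h v - h w
  by_cases hid : ∀ a : K, σ a = a
  · by_cases h2 : (2 : K) = 0
    · -- `σ = id` in characteristic `2`: then `h(v, x) = h(v, x')` for every `v`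
      have he : ∀ u : V, B x u = B x' u := fun u => by
        have e := h u
        simp only [hid] at e
        refine sub_eq_zero.mp (mul_self_eq_zero.mp ?_)
        linear_combination e + (B x' u * B x' u - B x u * B x' u) * h2
      rw [he v, he w]
    · exact forall_mul_apply_eq_of_forall_add_mul_apply_eq_of_two_ne_zero B h2 hT v w
  · push Not at hid
    obtain ⟨a, ha⟩ := hid
    exact forall_mul_apply_eq_of_forall_add_mul_apply_eq_of_ne B ha hT v w

/-! ## Rigidity from the diagonal coefficients -/

/-- **Rank-one hermitian rigidity from the diagonal coefficients.**  Let `σ` be an involution of the field `K` and let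
`B : V →ₛₗ[σ] V →ₗ[K] K` separate on the left.  If `h(v, x) σ(h(v, x)) = h(v, x') σ(h(v, x'))` for all `v`, then
`x' = λ • x` for some `λ` with `λ σ(λ) = 1` (polarisation `forall_mul_apply_eq_of_forall_mul_apply_self_eq`, then
`exists_smul_eq_of_forall_mul_apply_eq`).  No hermitian symmetry and no finite dimension are used.
[cite: Lang2002, Ch. XV §5] -/
theorem exists_smul_eq_of_forall_mul_apply_self_eq (B : V →ₛₗ[σ] V →ₗ[K] K) (hσ : ∀ a : K, σ (σ a) = a)
    (hB : B.SeparatingLeft) {x x' : V} (h : ∀ v : V, B x v * σ (B x v) = B x' v * σ (B x' v)) :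
    ∃ c : K, c * σ c = 1 ∧ x' = c • x :=
  exists_smul_eq_of_forall_mul_apply_eq B hσ hB (forall_mul_apply_eq_of_forall_mul_apply_self_eq B h)

/-- `iff` form of `exists_smul_eq_of_forall_mul_apply_self_eq`: for `σ` an involution and `B` separating on the left,
the diagonal coefficients `h(v, x) σ(h(v, x))` of `x` and `x'` agree for all `v` iff `x' = λ • x` with `λ σ(λ) = 1`.
[cite: Lang2002, Ch. XV §5] -/
theorem forall_mul_apply_self_eq_iff (B : V →ₛₗ[σ] V →ₗ[K] K) (hσ : ∀ a : K, σ (σ a) = a)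
    (hB : B.SeparatingLeft) {x x' : V} :
    (∀ v : V, B x v * σ (B x v) = B x' v * σ (B x' v)) ↔ ∃ c : K, c * σ c = 1 ∧ x' = c • x :=
  ⟨exists_smul_eq_of_forall_mul_apply_self_eq B hσ hB,
    fun ⟨_, hc, hx'⟩ v => forall_mul_apply_eq_of_smul_eq B hσ hc hx' v v⟩

/-! ## Operator forms, for a hermitian form -/

/-- For a hermitian form `B` (`LinearMap.IsSymm B`: `σ (B x y) = B y x`) the rank-one operator
`a_v := (B v).smulRight v : y ↦ h(y, v) v` is `B`-self-adjoint: `B (a_v u) w = B u (a_v w)` (both sides equal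
`h(v, u) h(w, v)`). [cite: Lang2002, Ch. XV §5] -/
theorem smulRight_selfAdjoint (B : V →ₛₗ[σ] V →ₗ[K] K) (hS : B.IsSymm) (v u w : V) :
    B ((B v).smulRight v u) w = B u ((B v).smulRight v w) := by
  simp only [LinearMap.smulRight_apply, LinearMap.map_smulₛₗ₂, map_smul, smul_eq_mul]
  rw [hS.eq v u]
  exact mul_comm _ _

/-- For a hermitian form `B`, the quadratic form of the rank-one self-adjoint operator `a_v = h(·, v) v` at `x` is the
diagonal coefficient of `x`: `B (a_v x) x = h(x, a_v x) = h(v, x) σ(h(v, x)) = B x v * σ (B x v)`.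
[cite: Lang2002, Ch. XV §5] -/
theorem apply_smulRight_apply_self (B : V →ₛₗ[σ] V →ₗ[K] K) (hS : B.IsSymm) (v x : V) :
    B ((B v).smulRight v x) x = B x v * σ (B x v) := by
  simp only [LinearMap.smulRight_apply, LinearMap.map_smulₛₗ₂, smul_eq_mul]
  rw [hS.eq v x, ← hS.eq x v]

/-- For a hermitian form `B`, the quadratic form of the rank-two self-adjoint operator
`a_{v,w} := (B v).smulRight w + (B w).smulRight v : y ↦ h(y, v) w + h(y, w) v` at `x` is the symmetrised
coefficient: `B (a_{v,w} x) x = h(v, x) σ(h(w, x)) + h(w, x) σ(h(v, x))`. [cite: Lang2002, Ch. XV §5] -/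
theorem apply_smulRight_add_smulRight_apply_self (B : V →ₛₗ[σ] V →ₗ[K] K) (hS : B.IsSymm) (v w x : V) :
    B (((B v).smulRight w + (B w).smulRight v) x) x = B x v * σ (B x w) + B x w * σ (B x v) := by
  simp only [LinearMap.add_apply, LinearMap.smulRight_apply, map_add, LinearMap.map_smulₛₗ₂, smul_eq_mul]
  rw [hS.eq v x, hS.eq w x, ← hS.eq x w, ← hS.eq x v]

/-- **Rank-one hermitian rigidity from the rank-one quadratic forms.**  Let `σ` be an involution of `K` and `B` a
hermitian form separating on the left (= non-degenerate).  If the quadratic forms of the rank-one self-adjoint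
operators `a_v = h(·, v) v` take the same value at `x` and `x'`, `B (a_v x) x = B (a_v x') x'` for all `v`, then
`x' = λ • x` with `λ σ(λ) = 1`. [cite: Lang2002, Ch. XV §5] -/
theorem exists_smul_eq_of_forall_smulRight_apply_self_eq (B : V →ₛₗ[σ] V →ₗ[K] K)
    (hσ : ∀ a : K, σ (σ a) = a) (hS : B.IsSymm) (hB : B.SeparatingLeft) {x x' : V}
    (h : ∀ v : V, B ((B v).smulRight v x) x = B ((B v).smulRight v x') x') :
    ∃ c : K, c * σ c = 1 ∧ x' = c • x :=
  exists_smul_eq_of_forall_mul_apply_self_eq B hσ hB fun v => by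
    rw [← apply_smulRight_apply_self B hS v x, ← apply_smulRight_apply_self B hS v x']
    exact h v

/-- **Rank-one hermitian rigidity from the symmetrised rank-two quadratic forms.**  Let `σ` be an involution of `K`,
`B` a hermitian form separating on the left, and assume `2 ≠ 0` in `K` or `σ ≠ id`.  If
`B (a_{v,w} x) x = B (a_{v,w} x') x'` for all `v, w`, where `a_{v,w} = h(·, v) w + h(·, w) v`, then `x' = λ • x` with
`λ σ(λ) = 1`.  (If `σ = id` and `2 = 0` every `a_{v,w}`-value vanishes and the conclusion fails.)
[cite: Lang2002, Ch. XV §5] -/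
theorem exists_smul_eq_of_forall_smulRight_add_smulRight_apply_self_eq (B : V →ₛₗ[σ] V →ₗ[K] K)
    (hσ : ∀ a : K, σ (σ a) = a) (hS : B.IsSymm) (hB : B.SeparatingLeft) (h2 : (2 : K) ≠ 0 ∨ ∃ a : K, σ a ≠ a)
    {x x' : V}
    (h : ∀ v w : V,
      B (((B v).smulRight w + (B w).smulRight v) x) x = B (((B v).smulRight w + (B w).smulRight v) x') x') :
    ∃ c : K, c * σ c = 1 ∧ x' = c • x := by
  have hT : ∀ v w : V,
      B x v * σ (B x w) + B x w * σ (B x v) = B x' v * σ (B x' w) + B x' w * σ (B x' v) := fun v w => by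
    rw [← apply_smulRight_add_smulRight_apply_self B hS v w x, ← apply_smulRight_add_smulRight_apply_self B hS v w x']
    exact h v w
  refine exists_smul_eq_of_forall_mul_apply_eq B hσ hB fun v w => ?_
  rcases h2 with h2 | ⟨a, ha⟩
  · exact forall_mul_apply_eq_of_forall_add_mul_apply_eq_of_two_ne_zero B h2 hT v w
  · exact forall_mul_apply_eq_of_forall_add_mul_apply_eq_of_ne B ha hT v w

/-- **Rank-one hermitian rigidity, quadratic form (headline).**  Let `σ` be an involution of the field `K` and
`B : V →ₛₗ[σ] V →ₗ[K] K` a hermitian form (`LinearMap.IsSymm B`) separating on the left (= non-degenerate).  If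
`x, x' ∈ V` satisfy `B (a x) x = B (a x') x'`, i.e. `h(x, a x) = h(x', a x')`, for every `B`-self-adjoint
`a : V →ₗ[K] V` (`B (a u) w = B u (a w)` for all `u, w`), then `x' = λ • x` for some `λ` with `λ σ(λ) = 1`.  Only the
rank-one self-adjoint operators `h(·, v) v` are used (`exists_smul_eq_of_forall_smulRight_apply_self_eq`); neither
finite dimension nor `2 ≠ 0` is needed. [cite: Lang2002, Ch. XV §5] -/
theorem exists_smul_eq_of_forall_selfAdjoint_apply_self_eq (B : V →ₛₗ[σ] V →ₗ[K] K)
    (hσ : ∀ a : K, σ (σ a) = a) (hS : B.IsSymm) (hB : B.SeparatingLeft) {x x' : V}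
    (h : ∀ a : V →ₗ[K] V, (∀ u w : V, B (a u) w = B u (a w)) → B (a x) x = B (a x') x') :
    ∃ c : K, c * σ c = 1 ∧ x' = c • x :=
  exists_smul_eq_of_forall_smulRight_apply_self_eq B hσ hS hB fun v => h _ (smulRight_selfAdjoint B hS v)

/-- The (trivial) converse of `exists_smul_eq_of_forall_selfAdjoint_apply_self_eq`: if `x' = λ • x` with
`λ σ(λ) = 1` then `B (a x) x = B (a x') x'` for EVERY linear `a : V →ₗ[K] V` (self-adjoint or not; no hypothesis on
`B` or `σ`). [cite: Lang2002, Ch. XV §5] -/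
theorem apply_self_eq_of_smul_eq (B : V →ₛₗ[σ] V →ₗ[K] K) {x x' : V} {c : K} (hc : c * σ c = 1)
    (hx' : x' = c • x) (a : V →ₗ[K] V) : B (a x) x = B (a x') x' := by
  subst hx'
  simp only [map_smul, LinearMap.map_smulₛₗ₂, smul_eq_mul]
  linear_combination (-(B (a x) x)) * hc

/-- `iff` form of the headline: for `σ` an involution and `B` hermitian non-degenerate, `B (a x) x = B (a x') x'` for
every `B`-self-adjoint `a` iff `x' = λ • x` for some `λ` with `λ σ(λ) = 1`. [cite: Lang2002, Ch. XV §5] -/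
theorem forall_selfAdjoint_apply_self_eq_iff (B : V →ₛₗ[σ] V →ₗ[K] K) (hσ : ∀ a : K, σ (σ a) = a)
    (hS : B.IsSymm) (hB : B.SeparatingLeft) {x x' : V} :
    (∀ a : V →ₗ[K] V, (∀ u w : V, B (a u) w = B u (a w)) → B (a x) x = B (a x') x') ↔
      ∃ c : K, c * σ c = 1 ∧ x' = c • x :=
  ⟨exists_smul_eq_of_forall_selfAdjoint_apply_self_eq B hσ hS hB,
    fun ⟨_, hc, hx'⟩ a _ => apply_self_eq_of_smul_eq B hc hx' a⟩

/-- Under the hypotheses of the headline, `x = 0 ↔ x' = 0` (the scalar `λ` is a unit).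
[cite: Lang2002, Ch. XV §5] -/
theorem eq_zero_iff_of_forall_selfAdjoint_apply_self_eq (B : V →ₛₗ[σ] V →ₗ[K] K)
    (hσ : ∀ a : K, σ (σ a) = a) (hS : B.IsSymm) (hB : B.SeparatingLeft) {x x' : V}
    (h : ∀ a : V →ₗ[K] V, (∀ u w : V, B (a u) w = B u (a w)) → B (a x) x = B (a x') x') :
    x = 0 ↔ x' = 0 := by
  obtain ⟨c, hc, rfl⟩ := exists_smul_eq_of_forall_selfAdjoint_apply_self_eq B hσ hS hB h
  have hc0 : c ≠ 0 := fun h0 => by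
    rw [h0, zero_mul] at hc
    exact zero_ne_one hc
  rw [smul_eq_zero, or_iff_right hc0]

end Literature.LinearAlgebra.Semilinear
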